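import Literature.NumberTheory.Transcendental.AnalytificationProjProofs
import Literature.AlgebraicGeometry.Motives.IntegralProjectiveSpace
import HarnessLib

/-!
# Field-valued points of projective space: homogeneous coordinates

For a field `k`, a field `L` with a `k`-algebra structure and `n : ℕ`, the `L`-valued points of
`ℙⁿ_k = Proj k[x₀, …, xₙ]` over `k` (`Literature.AlgebraicGeometry.Motives.AlgPoints
(projectiveSpace n k) L`, i.e. `k`-morphisms `Spec L → ℙⁿ_k`) are the classes of non-zero vectors
`z ∈ Lⁿ⁺¹` up to `Lˣ` (Hartshorne II Ex. 2.14 / Thm. 7.1 for `X = Spec L`; Görtz–Wedhorn I (13.8)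
with `T = Spec L`: `ℙⁿ(L) = (Lⁿ⁺¹ ∖ 0)/Lˣ` since line bundles on `Spec L` are trivial). This file
constructs the point with homogeneous coordinates `z` **through the standard affine charts**
`D₊(t) = Spec k[x]_{(t)}` (Hartshorne II Prop. 2.5):

* `ProjectiveSpace.awayEval L z hz : k[x]_{(t)} →ₐ[k] L`, `g/tᵐ ↦ g(z)/t(z)ᵐ`, for `t(z) ≠ 0`;
* `ProjectiveSpace.chartPoint`: the `L`-point `Spec L → Spec k[x]_{(t)} = D₊(t) ⊆ ℙⁿ_k`;
  independence of the chart (`chartPoint_eq_chartPoint`, through `D₊(t t')`, Mathlib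
  `Proj.SpecMap_awayMap_awayι`), invariance under scaling `z ↦ c z` (`chartPoint_smul`), and the
  membership criterion `chartPoint ∈ D₊(G) ↔ G(z) ≠ 0` (`pt_chartPoint_mem_basicOpen_iff`, Mathlib
  `Proj.awayι_preimage_basicOpen`);
* `ProjectiveSpace.pointOfVec k z hz` for `z ≠ 0`: the chart point for the first non-vanishing
  coordinate, equal to every chart point (`pointOfVec_eq_chartPoint`).

Surjectivity (every `L`-point has homogeneous coordinates) and injectivity up to `Lˣ` are in the
sequel `Motives/ProjectiveSpaceFieldPointsBijective`. The case `k = L = ℂ` with the point built by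
Mathlib's `Proj.fromOfGlobalSections` is `Literature.NumberTheory.Transcendental.pointOfVec`
(`AnalytificationProjProofs`), from which we reuse the `L`-points-of-`Spec` dictionary
`AlgPoints.ofAlgHom` / `AlgPoints.toAlgHom`.

## References

* R. Hartshorne, *Algebraic Geometry*, GTM 52 (1977): II Prop. 2.5, II Ex. 2.14, II Thm. 7.1.
  [Hartshorne1977]
* U. Görtz, T. Wedhorn, *Algebraic Geometry I*, 2nd ed. (2020): (13.8), p. 484. [GortzWedhorn2020]
-/

noncomputable section

open CategoryTheory AlgebraicGeometry HomogeneousLocalization MvPolynomial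

universe u

namespace Literature.AlgebraicGeometry.Motives

namespace ProjectiveSpace

variable {k : Type u} [Field k] {n : ℕ} (L : Type u) [Field L] [Algebra k L]

attribute [local instance] MvPolynomial.gradedAlgebra ProjBaseChange.algebraBase

local notation "𝒜" => MvPolynomial.homogeneousSubmodule (Fin (n + 1)) k

/-! ### Evaluation on the homogeneous localization `k[x]_{(t)}` -/

section AwayEval

variable {L}
variable {t : MvPolynomial (Fin (n + 1)) k} {d : ℕ}

/-- For `z ∈ Lⁿ⁺¹` with `t(z) ≠ 0`, evaluation at `z` extends to the localization `k[x]_t → L`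
(Mathlib `Localization.awayLift`). [folklore] -/
def awayEvalLoc (z : Fin (n + 1) → L) (hz : aeval z t ≠ 0) :
    Localization.Away t →+* L :=
  Localization.awayLift (aeval z).toRingHom t (isUnit_iff_ne_zero.mpr hz)

/-- `awayEvalLoc z hz (a / tʲ) = a(z) · (t(z)⁻¹)ʲ`. [folklore] -/
theorem awayEvalLoc_mk (z : Fin (n + 1) → L) (hz : aeval z t ≠ 0)
    (a : MvPolynomial (Fin (n + 1)) k) (j : ℕ) :
    awayEvalLoc z hz (Localization.mk a ⟨t ^ j, j, rfl⟩) = aeval z a * ((aeval z t)⁻¹) ^ j :=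
  Localization.awayLift_mk _ _ _ _ (mul_inv_cancel₀ hz) _

/-- `awayEvalLoc` restricted to `k[x]` is evaluation at `z`. [folklore] -/
@[simp]
theorem awayEvalLoc_algebraMap (z : Fin (n + 1) → L) (hz : aeval z t ≠ 0)
    (a : MvPolynomial (Fin (n + 1)) k) :
    awayEvalLoc z hz (algebraMap _ (Localization.Away t) a) = aeval z a := by
  rw [awayEvalLoc, Localization.awayLift, IsLocalization.Away.lift_eq]
  rfl

/-- **Evaluation at `z` on the degree-zero localization**: the `k`-algebra map
`k[x₀,…,xₙ]_{(t)} → L`, `g/tᵐ ↦ g(z)/t(z)ᵐ`, for `t(z) ≠ 0` (the `L`-point of the chart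
`D₊(t) = Spec k[x]_{(t)}` with homogeneous coordinates `z`; Hartshorne II Prop. 2.5, Ex. 2.14).
[folklore] -/
def awayEval (z : Fin (n + 1) → L) (hz : aeval z t ≠ 0) : Away 𝒜 t →ₐ[k] L where
  __ := (awayEvalLoc z hz).comp (algebraMap (Away 𝒜 t) (Localization.Away t))
  commutes' c := by
    simp only [RingHom.toMonoidHom_eq_coe, OneHom.toFun_eq_coe, MonoidHom.toOneHom_coe,
      MonoidHom.coe_coe, RingHom.coe_comp, Function.comp_apply]
    rw [HomogeneousLocalization.algebraMap_apply, ProjBaseChange.val_algebraMap,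
      IsScalarTower.algebraMap_apply k (MvPolynomial (Fin (n + 1)) k) (Localization.Away t),
      awayEvalLoc_algebraMap, MvPolynomial.algebraMap_eq, aeval_C]

/-- `awayEval` is `awayEvalLoc` on the underlying fraction (definitional unfolding). [folklore] -/
theorem awayEval_apply (z : Fin (n + 1) → L) (hz : aeval z t ≠ 0) (q : Away 𝒜 t) :
    awayEval z hz q = awayEvalLoc z hz q.val :=
  rfl

/-- `awayEval z hz (g/tᵐ) = g(z)/t(z)ᵐ`. [folklore] -/
theorem awayEval_mk (z : Fin (n + 1) → L) (hz : aeval z t ≠ 0) (ht : t ∈ 𝒜 d) {m : ℕ}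
    (g : MvPolynomial (Fin (n + 1)) k) (hg : g ∈ 𝒜 (m • d)) :
    awayEval z hz (Away.mk 𝒜 ht m g hg) = aeval z g / aeval z t ^ m := by
  rw [awayEval_apply, Away.val_mk, awayEvalLoc_mk, inv_pow, div_eq_mul_inv]

/-- Evaluating a homogeneous polynomial of degree `m` at `c • z` multiplies the value by `cᵐ`.
[folklore] -/
theorem aeval_smul_of_mem {m : ℕ} {g : MvPolynomial (Fin (n + 1)) k} (hg : g ∈ 𝒜 m) (c : L)
    (z : Fin (n + 1) → L) : aeval (c • z) g = c ^ m * aeval z g :=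
  isHomogeneous_aeval_const_mul ((mem_homogeneousSubmodule m g).mp hg) c z

/-- **Scaling invariance**: `awayEval (c • z) = awayEval z` for `c ≠ 0` — degree-zero fractions
take the same value on proportional vectors. [folklore] -/
theorem awayEval_smul (ht : t ∈ 𝒜 d) (z : Fin (n + 1) → L) (hz : aeval z t ≠ 0) (c : L)
    (hc : c ≠ 0) (hcz : aeval (c • z) t ≠ 0) :
    awayEval (t := t) (c • z) hcz = awayEval z hz := by
  refine AlgHom.ext fun q => ?_
  obtain ⟨m, g, hg, rfl⟩ := Away.mk_surjective 𝒜 ht q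
  rw [awayEval_mk _ _ ht, awayEval_mk _ _ ht, aeval_smul_of_mem hg, aeval_smul_of_mem ht, mul_pow,
    ← pow_mul, smul_eq_mul, mul_comm m d, mul_div_mul_left _ _ (pow_ne_zero _ hc)]

/-- Compatibility with enlarging the chart: evaluation on `k[x]_{(t t')}` composed with the
transition map `k[x]_{(t)} → k[x]_{(t t')}` (Mathlib `HomogeneousLocalization.awayMap`) is
evaluation on `k[x]_{(t)}`. [folklore] -/
theorem awayEval_comp_awayMap {t' x : MvPolynomial (Fin (n + 1)) k} {d' : ℕ}
    (ht' : t' ∈ 𝒜 d') (hx : x = t * t') (z : Fin (n + 1) → L) (hz : aeval z t ≠ 0)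
    (hxz : aeval z x ≠ 0) :
    (awayEval z hxz).toRingHom.comp (awayMap 𝒜 ht' hx) = (awayEval (t := t) z hz).toRingHom := by
  refine RingHom.ext fun q => ?_
  change awayEvalLoc z hxz (awayMap 𝒜 ht' hx q).val = awayEvalLoc z hz q.val
  rw [val_awayMap]
  rw [← RingHom.comp_apply]
  congr 1
  refine IsLocalization.ringHom_ext (Submonoid.powers t) (RingHom.ext fun a => ?_)
  simp only [RingHom.coe_comp, Function.comp_apply, Localization.awayLift,
    IsLocalization.Away.lift_eq]
  change awayEvalLoc z hxz (algebraMap _ _ a) = awayEvalLoc z hz (algebraMap _ _ a)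
  rw [awayEvalLoc_algebraMap, awayEvalLoc_algebraMap]

end AwayEval

/-! ### The chart `D₊(t)` as a `k`-scheme and its `L`-points -/

section Chart

variable {t : MvPolynomial (Fin (n + 1)) k} {d : ℕ}

/-- The open immersion `D₊(t) = Spec k[x]_{(t)} ⟶ ℙⁿ_k` as a morphism of `k`-schemes (Mathlib
`Proj.awayι`; over `Spec k` by `ProjBaseChangeRing.awayι_projToSpec`). Hartshorne II Prop. 2.5.
[folklore] -/
def awayChartι (ht : t ∈ 𝒜 d) (hd : 0 < d) :
    specOver k (Away 𝒜 t) ⟶ projectiveSpace n k :=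
  Over.homMk (Proj.awayι 𝒜 t ht hd) (ProjBaseChangeRing.awayι_projToSpec (Fin (n + 1)) ht hd)

/-- The underlying morphism of `awayChartι` is Mathlib's `Proj.awayι` (`rfl`). [folklore] -/
@[simp]
theorem awayChartι_left (ht : t ∈ 𝒜 d) (hd : 0 < d) :
    (awayChartι ht hd).left = Proj.awayι 𝒜 t ht hd :=
  rfl

/-- `D₊(t) ⟶ ℙⁿ_k` is an open immersion. [folklore] -/
instance isOpenImmersion_awayChartι_left (ht : t ∈ 𝒜 d) (hd : 0 < d) :
    IsOpenImmersion (awayChartι ht hd).left :=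
  inferInstanceAs (IsOpenImmersion (Proj.awayι 𝒜 t ht hd))

/-- The image of `D₊(t) ⟶ ℙⁿ_k` is the basic open `D₊(t)` (Mathlib `Proj.opensRange_awayι`).
[folklore] -/
theorem opensRange_awayChartι_left (ht : t ∈ 𝒜 d) (hd : 0 < d) :
    (awayChartι ht hd).left.opensRange = Proj.basicOpen 𝒜 t :=
  Proj.opensRange_awayι 𝒜 t ht hd

variable {L}

/-- **The `L`-point of `ℙⁿ_k` with homogeneous coordinates `z`, built through the chart `D₊(t)`**
(`t(z) ≠ 0`): `Spec L → Spec k[x]_{(t)} = D₊(t) ⊆ ℙⁿ_k`, the first map being `Spec` of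
`awayEval z` (Hartshorne II Prop. 2.5 and Ex. 2.14). [folklore] -/
def chartPoint (ht : t ∈ 𝒜 d) (hd : 0 < d) (z : Fin (n + 1) → L) (hz : aeval z t ≠ 0) :
    AlgPoints (projectiveSpace n k) L :=
  AlgPoints.map (awayChartι ht hd) (AlgPoints.ofAlgHom (awayEval z hz))

/-- The underlying morphism of `chartPoint` is `Spec (awayEval z) ≫ awayι`. [folklore] -/
theorem chartPoint_left (ht : t ∈ 𝒜 d) (hd : 0 < d) (z : Fin (n + 1) → L)
    (hz : aeval z t ≠ 0) :
    (chartPoint ht hd z hz).left =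
      Spec.map (CommRingCat.ofHom (awayEval z hz).toRingHom) ≫ Proj.awayι 𝒜 t ht hd :=
  rfl

/-- **Independence of the chart**: for `t(z) ≠ 0` and `t'(z) ≠ 0` the points built through `D₊(t)`
and `D₊(x)`, `x = t t'`, agree (Mathlib `Proj.SpecMap_awayMap_awayι` and `awayEval_comp_awayMap`).
[folklore] -/
theorem chartPoint_eq_chartPoint_mul (ht : t ∈ 𝒜 d) (hd : 0 < d)
    {t' x : MvPolynomial (Fin (n + 1)) k} {d' : ℕ} (ht' : t' ∈ 𝒜 d') (hx : x = t * t')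
    (z : Fin (n + 1) → L) (hz : aeval z t ≠ 0) (hz' : aeval z t' ≠ 0) :
    chartPoint ht hd z hz =
      chartPoint (t := x) (hx ▸ SetLike.mul_mem_graded ht ht') (Nat.add_pos_left hd d') z
        (by rw [hx, map_mul]; exact mul_ne_zero hz hz') := by
  ext : 1
  rw [chartPoint_left, chartPoint_left,
    ← Proj.SpecMap_awayMap_awayι 𝒜 ht hd ht' hx, ← Category.assoc, ← Spec.map_comp,
    ← CommRingCat.ofHom_comp, awayEval_comp_awayMap ht' hx z hz]

/-- Hence the points built through any two charts `D₊(t)`, `D₊(t')` containing them agree.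
[folklore] -/
theorem chartPoint_eq_chartPoint (ht : t ∈ 𝒜 d) (hd : 0 < d)
    {t' : MvPolynomial (Fin (n + 1)) k} {d' : ℕ} (ht' : t' ∈ 𝒜 d') (hd' : 0 < d')
    (z : Fin (n + 1) → L) (hz : aeval z t ≠ 0) (hz' : aeval z t' ≠ 0) :
    chartPoint ht hd z hz = chartPoint ht' hd' z hz' :=
  (chartPoint_eq_chartPoint_mul ht hd ht' rfl z hz hz').trans
    (chartPoint_eq_chartPoint_mul ht' hd' ht (mul_comm t t') z hz' hz).symm

/-- **Scaling invariance** of the chart point: `[c z] = [z]` for `c ≠ 0`. [folklore] -/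
theorem chartPoint_smul (ht : t ∈ 𝒜 d) (hd : 0 < d) (z : Fin (n + 1) → L)
    (hz : aeval z t ≠ 0) (c : L) (hc : c ≠ 0) (hcz : aeval (c • z) t ≠ 0) :
    chartPoint ht hd (c • z) hcz = chartPoint ht hd z hz := by
  unfold chartPoint
  rw [awayEval_smul ht z hz c hc hcz]

/-- **Membership in basic opens**: the point with homogeneous coordinates `z` lies in `D₊(G)` iff
`G(z) ≠ 0`, for `G` homogeneous of positive degree (Mathlib `Proj.awayι_preimage_basicOpen`:
`D₊(t) ∩ D₊(G) = D(Gᵈ/tᵐ)`). Hartshorne II Prop. 2.5. [folklore] -/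
theorem pt_chartPoint_mem_basicOpen_iff (ht : t ∈ 𝒜 d) (hd : 0 < d) (z : Fin (n + 1) → L)
    (hz : aeval z t ≠ 0) {m : ℕ} (hm : 0 < m) {G : MvPolynomial (Fin (n + 1)) k} (hG : G ∈ 𝒜 m) :
    (chartPoint ht hd z hz).pt ∈ Proj.basicOpen 𝒜 G ↔ aeval z G ≠ 0 := by
  have key := Proj.awayι_preimage_basicOpen 𝒜 ht hd hG hm
  change (Proj.awayι 𝒜 t ht hd) ((AlgPoints.ofAlgHom (awayEval z hz)).pt) ∈ Proj.basicOpen 𝒜 G ↔ _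
  rw [← Scheme.Hom.mem_preimage (f := Proj.awayι 𝒜 t ht hd), key]
  refine (AlgPoints.pt_ofAlgHom_mem_basicOpen_iff (awayEval z hz)
    (Away.isLocalizationElem ht hG)).trans ?_
  rw [Away.isLocalizationElem, awayEval_mk _ _ ht, div_ne_zero_iff,
    and_iff_left (pow_ne_zero _ hz), map_pow]
  exact pow_ne_zero_iff hd.ne'

/-- In particular the chart point through `D₊(t)` lies in `D₊(t)`. [folklore] -/
theorem pt_chartPoint_mem_basicOpen_self (ht : t ∈ 𝒜 d) (hd : 0 < d) (z : Fin (n + 1) → L)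
    (hz : aeval z t ≠ 0) :
    (chartPoint ht hd z hz).pt ∈ Proj.basicOpen 𝒜 t :=
  (pt_chartPoint_mem_basicOpen_iff ht hd z hz hd ht).mpr hz

end Chart

/-! ### The point with homogeneous coordinates `z ≠ 0` -/

section PointOfVec

variable {L}

/-- The first index at which `z ≠ 0` does not vanish. [folklore] -/
def firstNe (z : Fin (n + 1) → L) (hz : z ≠ 0) : Fin (n + 1) :=
  haveI := Classical.decPred fun i => z i ≠ 0
  (Finset.univ.filter fun i => z i ≠ 0).min' (by
    obtain ⟨i, hi⟩ := Function.ne_iff.mp hz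
    exact ⟨i, Finset.mem_filter.mpr ⟨Finset.mem_univ i, hi⟩⟩)

/-- `z (firstNe z hz) ≠ 0`. [folklore] -/
theorem apply_firstNe_ne_zero (z : Fin (n + 1) → L) (hz : z ≠ 0) : z (firstNe z hz) ≠ 0 := by
  classical
  unfold firstNe
  have h := Finset.min'_mem (Finset.univ.filter fun i => z i ≠ 0) (by
    obtain ⟨i, hi⟩ := Function.ne_iff.mp hz
    exact ⟨i, Finset.mem_filter.mpr ⟨Finset.mem_univ i, hi⟩⟩)
  rw [Finset.mem_filter] at h
  convert h.2

/-- `firstNe` is invariant under scaling by `c ≠ 0`. [folklore] -/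
theorem firstNe_smul (z : Fin (n + 1) → L) (hz : z ≠ 0) (c : L) (hc : c ≠ 0)
    (hcz : c • z ≠ 0) :
    firstNe (c • z) hcz = firstNe z hz := by
  classical
  unfold firstNe
  congr 1
  · ext i
    simp [hc]

/-- `aeval z (X i) ≠ 0` from `z i ≠ 0`. [folklore] -/
theorem aeval_X_ne_zero {z : Fin (n + 1) → L} {i : Fin (n + 1)} (hi : z i ≠ 0) :
    aeval z (X i : MvPolynomial (Fin (n + 1)) k) ≠ 0 := by
  rwa [aeval_X]

/-- **The `L`-point of `ℙⁿ_k` with homogeneous coordinates `z ≠ 0`** (through the chart `D₊(xᵢ)` of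
the first non-zero coordinate; equal to the point through any chart containing it,
`pointOfVec_eq_chartPoint`). Hartshorne II Ex. 2.14 / Thm. 7.1; Görtz–Wedhorn I (13.8).
[folklore] -/
def pointOfVec (k : Type u) [Field k] {L : Type u} [Field L] [Algebra k L] (z : Fin (n + 1) → L)
    (hz : z ≠ 0) : AlgPoints (projectiveSpace n k) L :=
  chartPoint (X_mem (firstNe z hz)) one_pos z (aeval_X_ne_zero (apply_firstNe_ne_zero z hz))

/-- `pointOfVec z` is the chart point through every `D₊(t)` with `t(z) ≠ 0`. [folklore] -/
theorem pointOfVec_eq_chartPoint (z : Fin (n + 1) → L) (hz : z ≠ 0)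
    {t : MvPolynomial (Fin (n + 1)) k} {d : ℕ} (ht : t ∈ 𝒜 d) (hd : 0 < d)
    (hzt : aeval z t ≠ 0) :
    pointOfVec k z hz = chartPoint ht hd z hzt :=
  chartPoint_eq_chartPoint (X_mem (firstNe z hz)) one_pos ht hd z
    (aeval_X_ne_zero (apply_firstNe_ne_zero z hz)) hzt

/-- **Scaling invariance**: `pointOfVec (c • z) = pointOfVec z` for `c ≠ 0`. [folklore] -/
theorem pointOfVec_smul (z : Fin (n + 1) → L) (hz : z ≠ 0) (c : L) (hc : c ≠ 0)
    (hcz : c • z ≠ 0) : pointOfVec k (c • z) hcz = pointOfVec k z hz := by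
  have hi := apply_firstNe_ne_zero z hz
  rw [pointOfVec_eq_chartPoint (c • z) hcz (X_mem (firstNe z hz)) one_pos
    (by rw [aeval_X, Pi.smul_apply, smul_eq_mul]; exact mul_ne_zero hc hi)]
  exact chartPoint_smul _ _ z _ c hc _

/-- **Membership in basic opens**: `pointOfVec z ∈ D₊(G) ↔ G(z) ≠ 0` for `G` homogeneous of positive
degree. Hartshorne II Prop. 2.5. [folklore] -/
theorem pt_pointOfVec_mem_basicOpen_iff (z : Fin (n + 1) → L) (hz : z ≠ 0) {m : ℕ}
    (hm : 0 < m) {G : MvPolynomial (Fin (n + 1)) k} (hG : G ∈ 𝒜 m) :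
    (pointOfVec k z hz).pt ∈ Proj.basicOpen 𝒜 G ↔ aeval z G ≠ 0 :=
  pt_chartPoint_mem_basicOpen_iff _ _ z _ hm hG

/-- `pointOfVec z ∈ D₊(xᵢ) ↔ zᵢ ≠ 0`. [folklore] -/
theorem pt_pointOfVec_mem_basicOpen_X_iff (z : Fin (n + 1) → L) (hz : z ≠ 0) (i : Fin (n + 1)) :
    (pointOfVec k z hz).pt ∈ Proj.basicOpen 𝒜 (X i) ↔ z i ≠ 0 := by
  rw [pt_pointOfVec_mem_basicOpen_iff z hz one_pos (X_mem i), aeval_X]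

/-- `pointOfVec z` lies in the zero locus `V₊(G)` iff `G(z) = 0` (`G` homogeneous of positive
degree). [folklore] -/
theorem pt_pointOfVec_mem_zeroLocus_iff (z : Fin (n + 1) → L) (hz : z ≠ 0) {m : ℕ}
    (hm : 0 < m) {G : MvPolynomial (Fin (n + 1)) k} (hG : G ∈ 𝒜 m) :
    (pointOfVec k z hz).pt ∈ ProjectiveSpectrum.zeroLocus 𝒜 {G} ↔ aeval z G = 0 := by
  have h := pt_pointOfVec_mem_basicOpen_iff z hz hm hG
  have h' : (pointOfVec k z hz).pt ∈ Proj.basicOpen 𝒜 G ↔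
      G ∉ ((pointOfVec k z hz).pt).asHomogeneousIdeal := Iff.rfl
  change ({G} : Set (MvPolynomial (Fin (n + 1)) k)) ⊆
    (((pointOfVec k z hz).pt).asHomogeneousIdeal : Set (MvPolynomial (Fin (n + 1)) k)) ↔ _
  rw [Set.singleton_subset_iff, SetLike.mem_coe]
  tauto

end PointOfVec

end ProjectiveSpace

end Literature.AlgebraicGeometry.Motives
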